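import Summits.AtomisticToContinuum.Crystallization.Theorems.ChartedZeroExcessLayeredLatticeLiouvilleXP

/-!
# Zero-excess layered lattice Liouville — part XQ (lens-2 g59, node «SBGlueC4e»): the HISTORY bound and the step's (I4ˢ) / coherence inputs

Critic rows 1133/1135 (C4 «the history term; `δ_*` re-verified at every level with `ϑ₁, ω₁` fixed before `K₀`»), leaf (2) `SubWindowBudgetGlueBPG` of
`stmt-AtomisticToContinuum-26636`.

* XQ.1 ★ `TowerInv.hist` — the HISTORY BOUND of the comparison window of level `ℓ`:
  `E(φ_ℓ)(B_{m_w(ℓ)}) ≤ Rhist·(2p_π + 54Δ²)·#B_{n_{ℓ+1}}`, PARENT `π = ℓ − k₀` (XK `idxEnergy_pullDisp_iterate_le_of_lipschitz` between the charts `π → ℓ`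
  with the RECENT drift `Δ = D_ℓ − D_π ≤ 2k₀√(Cm·Q)`, `Q = p_{ℓ+1}/θ₁^{k₀+1}`, `p_π ≤ Q`; the window `m_w(ℓ) ≤ K_w n_ℓ ≤ n_π` since `K_w t_C^{k₀} ≤ 1`), or,
  when `ℓ < k₀`, the TOP REGISTRATION (XL `idxEnergy_pullDisp_top_le`, `OK.hreg`: `≤ P₀ n₀³ ≤ P₀·#B_{n_{ℓ+1}}/t_C^{3(k₀+1)}`).
* XQ.2 the inputs of XK `sbModeStep` at level `ℓ` that come from the tower: the (I4ˢ) instance (from `TH.TF` through the level's chart class `(1/25, 3)`,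
  bijectivity, tear-freeness and the far budget XP `TowerInv.far`), the coherence region (`TH.coh_region`), the coherence slack `≤ K.δs ≤ 1/4` and the
  window inequalities `n + ϱ/c + 1 ≤ m_w`, `(2τ+8)(9/c) ≤ m_w`, `(28/25)(6C₁ n + 8) < t`.
-/

noncomputable section

open scoped BigOperators InnerProductSpace RealInnerProductSpace
open Set Function Metric
open Summit.AtomisticToContinuum.Crystallization.Theorems.ChartedPlanarOrderRigidityDoor (E3 IsClean IsNash atomsIn)
open Summit.AtomisticToContinuum.Crystallization.Theorems.ChartedPlanarOrderDensityDichotomy (μS IsSep nK nK_nonneg)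
open Summit.AtomisticToContinuum.Crystallization.Theorems.ChartedPlanarOrderCleanScaleP (IsCleanP IsDoorSetP isCleanP_one_iff)
open Summit.AtomisticToContinuum.Crystallization.Theorems.ChartedPlanarOrderMesoCut (LayeredHom)
open Summit.AtomisticToContinuum.Crystallization.Theorems.ChartedPlanarOrderDoorLayered (Layered layeredHom_eq_layered atomsIn_subset)
open Summit.AtomisticToContinuum.Crystallization.Theorems.ChartedPlanarOrderDoorLayeredOsc (IsTwoShellAffineGood)

namespace Summit.AtomisticToContinuum.Crystallization.Theorems.ChartedZeroExcessLayeredLatticeLiouville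

section Hist

variable {K : SBK} {S : Set E3} {Ψ₀ : E3 → E3} {st₀ : Lev} {x : E3} {X₀ : Cell 2 × ℤ} {ℓ : ℕ} {lev : ℕ → Lev}

/-! ### XQ.1  The history bound -/

/-- the count of the comparison window against the next ball: `#B_{m_w(ℓ)} ≤ Rhist·#B_{n_{ℓ+1}}`. -/
theorem SBK.ncard_mw_le (hK : K.OK) (X₀ : Cell 2 × ℤ) (hℓ : K.nlo ≤ K.n ℓ) :
    ((idxBall X₀ (K.mw ℓ)).ncard : ℝ) ≤ K.Rhist * ((idxBall X₀ (K.n (ℓ + 1))).ncard : ℝ) := by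
  have hKw := SBK.one_le_Kw hK; have htC := hK.htC
  obtain ⟨hmw1, -⟩ := SBK.mw_le hK hℓ
  have h1 : ((idxBall X₀ (K.mw ℓ)).ncard : ℝ) ≤ ((idxBall X₀ (K.Kw * K.n ℓ)).ncard : ℝ) := by
    exact_mod_cast Set.ncard_le_ncard (idxBall_mono X₀ hmw1) (finite_idxBall X₀ _)
  have hn1 : 1 ≤ K.Kw * K.n ℓ := one_le_mul_of_one_le_of_one_le hKw (SBK.one_le_n hK hℓ)
  have h2 := ncard_idxBall_le_ratio X₀ hn1 (show 0 < K.tC / K.Kw by positivity)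
  have e1 : K.tC / K.Kw * (K.Kw * K.n ℓ) = K.n (ℓ + 1) := by rw [SBK.n_succ]; field_simp
  have e2 : 27 / (K.tC / K.Kw) ^ 3 = 27 * K.Kw ^ 3 / K.tC ^ 3 := by rw [div_pow]; field_simp
  rw [e1, e2] at h2
  have h3 : 27 * K.Kw ^ 3 / K.tC ^ 3 ≤ K.Rhist := by
    unfold SBK.Rhist
    exact div_le_div_of_nonneg_left (by positivity) (by positivity) (pow_le_pow_of_le_one htC.le (SBK.tC_le_one hK) (by omega))
  have h4 : (0 : ℝ) ≤ ((idxBall X₀ (K.n (ℓ + 1))).ncard : ℝ) := by positivity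
  exact h1.trans (h2.trans (mul_le_mul_of_nonneg_right h3 h4))

/-- the RECENT DRIFT between a level and an ancestor at most `k₀` levels up. -/
theorem TowerInv.drift_recent (T : TH K S Ψ₀ st₀ x X₀) (hT : TowerInv K S Ψ₀ st₀ X₀ ℓ lev) {π : ℕ} (hπℓ : π ≤ ℓ) (hℓπ : ℓ ≤ π + K.k₀) :
    0 ≤ (lev ℓ).D - (lev π).D ∧
      ((lev ℓ).D - (lev π).D) ^ 2 ≤ 4 * (K.k₀ : ℝ) ^ 2 * K.Cm * (K.p (ℓ + 1) / K.θ₁ ^ (K.k₀ + 1)) := by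
  have hK := T.ok
  have hCm := SBK.Cm_pos hK
  set Q : ℝ := K.p (ℓ + 1) / K.θ₁ ^ (K.k₀ + 1) with hQ
  have hQ0 : 0 ≤ Q := div_nonneg (SBK.p_nonneg hK _) (pow_nonneg (SBK.θ₁_nonneg hK) _)
  obtain ⟨-, hDle⟩ := hT.lip ℓ le_rfl π hπℓ
  have hΔ0 : 0 ≤ (lev ℓ).D - (lev π).D := by linarith only [hDle]
  have hsteps : ∀ i, π ≤ i → i < ℓ → (fun j => (lev j).D) (i + 1) - (fun j => (lev j).D) i ≤ 2 * Real.sqrt (K.Cm * Q) := by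
    intro i hi1 hi2
    have h1 := hT.step i hi2
    have h2 : K.p i ≤ Q := SBK.p_le_hist hK (by omega) (by omega)
    have h3 : Real.sqrt (K.Cm * K.p i) ≤ Real.sqrt (K.Cm * Q) := Real.sqrt_le_sqrt (mul_le_mul_of_nonneg_left h2 hCm.le)
    simp only
    linarith only [h1, h3]
  have hΔle := SBK.sub_le_mul_of_steps (f := fun j => (lev j).D) hπℓ hsteps
  have hk : ((ℓ - π : ℕ) : ℝ) ≤ (K.k₀ : ℝ) := by exact_mod_cast (show ℓ - π ≤ K.k₀ by omega)
  have hsq : 0 ≤ 2 * Real.sqrt (K.Cm * Q) := by positivity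
  have hΔk : (lev ℓ).D - (lev π).D ≤ (K.k₀ : ℝ) * (2 * Real.sqrt (K.Cm * Q)) := hΔle.trans (mul_le_mul_of_nonneg_right hk hsq)
  refine ⟨hΔ0, ?_⟩
  have h1 := pow_le_pow_left₀ hΔ0 hΔk 2
  have h2 : ((K.k₀ : ℝ) * (2 * Real.sqrt (K.Cm * Q))) ^ 2 = 4 * (K.k₀ : ℝ) ^ 2 * K.Cm * Q := by
    rw [mul_pow, mul_pow, Real.sq_sqrt (by positivity)]; ring
  linarith only [h1, h2]

/-- the PARENT's energy on the comparison window when `k₀ ≤ ℓ` (`π = ℓ − k₀`, `m_w(ℓ) ≤ n_π`, `#B_{n_π} ≤ Rhist·#B_{n_{ℓ+1}}`). -/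
theorem TowerInv.hist_parent (T : TH K S Ψ₀ st₀ x X₀) (hT : TowerInv K S Ψ₀ st₀ X₀ ℓ lev) (hℓ1 : K.nlo ≤ K.n (ℓ + 1)) (hk : K.k₀ ≤ ℓ) :
    idxEnergy (levφ S Ψ₀ st₀ (lev (ℓ - K.k₀))) (idxBall X₀ (K.mw ℓ)) ≤ K.p (ℓ - K.k₀) * (K.Rhist * ((idxBall X₀ (K.n (ℓ + 1))).ncard : ℝ)) := by
  have hK := T.ok
  have htC := hK.htC; have hKw := SBK.one_le_Kw hK
  have hℓ : K.nlo ≤ K.n ℓ := hℓ1.trans (SBK.n_succ_le hK ℓ)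
  set π : ℕ := ℓ - K.k₀ with hπ
  have hπℓ : π ≤ ℓ := Nat.sub_le ℓ K.k₀
  have hℓπ : ℓ = π + K.k₀ := by omega
  have hOπ := hT.levOK π hπℓ
  have hnπ : K.nlo ≤ K.n π := hℓ.trans (SBK.n_anti hK hπℓ)
  obtain ⟨hmw1, -⟩ := SBK.mw_le hK hℓ
  have hnℓ : K.n ℓ = K.n π * K.tC ^ K.k₀ := by rw [hℓπ, SBK.n_add]
  have hmwπ : K.mw ℓ ≤ K.n π := by
    have h2 : K.Kw * K.n ℓ = K.n π * (K.Kw * K.tC ^ K.k₀) := by rw [hnℓ]; ring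
    have h3 : K.n π * (K.Kw * K.tC ^ K.k₀) ≤ K.n π * 1 := mul_le_mul_of_nonneg_left hK.hKwk (SBK.n_pos hK π).le
    linarith only [hmw1, h2, h3]
  have hmono := idxEnergy_mono_set (idxBall_mono X₀ hmwπ) (finite_idxBall X₀ _) (levφ S Ψ₀ st₀ (lev π))
  refine hmono.trans (hOπ.energy.trans (mul_le_mul_of_nonneg_left ?_ (SBK.p_nonneg hK π)))
  -- `#B_{n_π} ≤ (27/t_C^{3(k₀+1)})·#B_{n_{ℓ+1}} ≤ Rhist·#B_{n_{ℓ+1}}`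
  have h2 := ncard_idxBall_le_ratio X₀ (SBK.one_le_n hK hnπ) (pow_pos htC (K.k₀ + 1))
  have e1 : K.tC ^ (K.k₀ + 1) * K.n π = K.n (ℓ + 1) := by
    rw [show ℓ + 1 = π + (K.k₀ + 1) by omega, SBK.n_add]; ring
  rw [e1, ← pow_mul] at h2
  have h3 : 27 / K.tC ^ ((K.k₀ + 1) * 3) ≤ K.Rhist := by
    unfold SBK.Rhist
    rw [mul_comm (K.k₀ + 1) 3]
    refine div_le_div_of_nonneg_right ?_ (by positivity)
    have := one_le_pow₀ (n := 3) hKw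
    linarith only [this]
  exact h2.trans (mul_le_mul_of_nonneg_right h3 (by positivity))

/-- the TOP REGISTRATION's energy on the comparison window when `ℓ < k₀`: `≤ P₀ n₀³ ≤ P₀·Rhist·#B_{n_{ℓ+1}}`. -/
theorem TH.hist_top (T : TH K S Ψ₀ st₀ x X₀) (hℓ1 : K.nlo ≤ K.n (ℓ + 1)) (hk : ℓ < K.k₀) :
    idxEnergy (levφ S Ψ₀ st₀ st₀) (idxBall X₀ (K.mw ℓ)) ≤ K.P₀ * (K.Rhist * ((idxBall X₀ (K.n (ℓ + 1))).ncard : ℝ)) := by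
  have hK := T.ok
  have htC := hK.htC; have hKw := SBK.one_le_Kw hK
  have hℓ : K.nlo ≤ K.n ℓ := hℓ1.trans (SBK.n_succ_le hK ℓ)
  obtain ⟨hmw1, hmw2⟩ := SBK.mw_le hK hℓ
  rw [T.levφ_zero]
  have hR : 0 < K.R := by linarith only [hK.hR]
  have hn0 := SBK.n0_pos hK
  have hC₁ := (SBK.C₁_pos hK).le
  have hwin : ‖atomOf S Ψ₀ (chartGen₁ st₀.L) (chartGen₂ st₀.L) st₀.w₁ X₀‖ + 28 / 25 * (6 * K.C₁ * K.mw ℓ + 8) +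
      28 / 25 * (6 * K.C₁ + 8) ≤ 9 * K.R := by
    have h1 := T.norm_x
    have h2 := hK.hwin
    have h3 : K.C₁ * K.mw ℓ ≤ K.C₁ * (K.Kw * K.n0) := mul_le_mul_of_nonneg_left (hmw1.trans hmw2) hC₁
    have h4 : 0 ≤ 28 / 25 * (6 * K.C₁ * (2 * K.ϱ / K.c₀) + 8) := by have := hK.hϱ; have := hK.hc₀; positivity
    linarith only [h1, h2, h3, h4]
  have h1 := idxEnergy_pullDisp_top_le T.bij₀ T.iso T.clean₀ T.tame₀ T.c₀_pos T.cryst₀ T.hδ T.sep hR T.reg' X₀ hwin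
  have h2 := nK_atomsIn_le T.hδ T.sep (D := 9 * K.R) (by positivity)
  have hdB : 0 ≤ dictB K.C₁ K.δ := by unfold dictB; have := T.hδ; positivity
  have h3 : dictB K.C₁ K.δ * (9 * K.Cg * K.η * nK (atomsIn (μS S) 0 (9 * K.R))) ≤
      dictB K.C₁ K.δ * (9 * K.Cg * K.η * (2 * (9 * K.R + 1) / K.δ + 1) ^ 3) := by
    have : 0 ≤ 9 * K.Cg * K.η := by have := hK.hCg; have := hK.hη; positivity
    exact mul_le_mul_of_nonneg_left (mul_le_mul_of_nonneg_left h2 this) hdB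
  refine h1.trans (h3.trans (hK.hreg.trans (mul_le_mul_of_nonneg_left ?_ hK.hP₀)))
  -- `n₀³ ≤ Rhist·#B_{n_{ℓ+1}}`
  have h5 : K.n0 * K.tC ^ (K.k₀ + 1) ≤ K.n (ℓ + 1) := by
    rw [show K.n (ℓ + 1) = K.n0 * K.tC ^ (ℓ + 1) by rw [← SBK.n_zero, ← SBK.n_add, zero_add]]
    exact mul_le_mul_of_nonneg_left (pow_le_pow_of_le_one htC.le (SBK.tC_le_one hK) (by omega)) hn0.le
  have h6 : (K.n0 * K.tC ^ (K.k₀ + 1)) ^ 3 ≤ ((idxBall X₀ (K.n (ℓ + 1))).ncard : ℝ) :=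
    (pow_le_pow_left₀ (by positivity) h5 3).trans (cube_le_ncard_idxBall X₀ (SBK.n_pos hK _).le)
  have ht3 : 0 < K.tC ^ (3 * (K.k₀ + 1)) := by positivity
  have e : (K.n0 * K.tC ^ (K.k₀ + 1)) ^ 3 = K.n0 ^ 3 * K.tC ^ (3 * (K.k₀ + 1)) := by
    rw [mul_pow, ← pow_mul, mul_comm (K.k₀ + 1) 3]
  rw [e] at h6
  unfold SBK.Rhist
  rw [div_mul_eq_mul_div, le_div_iff₀ ht3]
  have h7 : ((idxBall X₀ (K.n (ℓ + 1))).ncard : ℝ) ≤ 27 * K.Kw ^ 3 * ((idxBall X₀ (K.n (ℓ + 1))).ncard : ℝ) := by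
    have := one_le_pow₀ (n := 3) hKw
    have hN : (0 : ℝ) ≤ ((idxBall X₀ (K.n (ℓ + 1))).ncard : ℝ) := by positivity
    nlinarith only [this, hN]
  exact h6.trans h7

/-- ★ the HISTORY BOUND of the comparison window (module docstring XQ.1). [this file, g59] -/
theorem TowerInv.hist (T : TH K S Ψ₀ st₀ x X₀) (hT : TowerInv K S Ψ₀ st₀ X₀ ℓ lev) (hℓ1 : K.nlo ≤ K.n (ℓ + 1)) :
    ∃ pπ Δ : ℝ, 0 ≤ pπ ∧ pπ ≤ K.p (ℓ + 1) / K.θ₁ ^ (K.k₀ + 1) ∧ Δ ^ 2 ≤ 4 * (K.k₀ : ℝ) ^ 2 * K.Cm * (K.p (ℓ + 1) / K.θ₁ ^ (K.k₀ + 1)) ∧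
      idxEnergy (levφ S Ψ₀ st₀ (lev ℓ)) (idxBall X₀ (K.mw ℓ)) ≤
        K.Rhist * (2 * pπ + 54 * Δ ^ 2) * ((idxBall X₀ (K.n (ℓ + 1))).ncard : ℝ) := by
  have hK := T.ok
  have hℓ : K.nlo ≤ K.n ℓ := hℓ1.trans (SBK.n_succ_le hK ℓ)
  set Nn1 : ℝ := ((idxBall X₀ (K.n (ℓ + 1))).ncard : ℝ) with hNn1
  have hRh := (SBK.Rhist_pos hK).le
  -- the parent level `π = ℓ − k₀` (`= 0` when `ℓ < k₀`)
  set π : ℕ := ℓ - K.k₀ with hπ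
  have hπℓ : π ≤ ℓ := Nat.sub_le ℓ K.k₀
  have hOπ := hT.levOK π hπℓ
  have hOℓ := hT.levOK ℓ le_rfl
  obtain ⟨hlip, -⟩ := hT.lip ℓ le_rfl π hπℓ
  have hnπ : K.nlo ≤ K.n π := hℓ.trans (SBK.n_anti hK hπℓ)
  obtain ⟨hΔ0, hΔ2⟩ := hT.drift_recent T hπℓ (by omega)
  -- (E4) between the parent and the level on the comparison window
  have hE4 := idxEnergy_pullDisp_iterate_le_of_lipschitz T.bij₀ T.c₀_pos T.cryst₀ (hOπ.c_pos T hnπ) hOπ.cryst (hOℓ.c_pos T hℓ) hOℓ.cryst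
    hlip (idxBallF X₀ (K.mw ℓ))
  have hN : ((idxBallF X₀ (K.mw ℓ)).card : ℝ) = ((idxBall X₀ (K.mw ℓ)).ncard : ℝ) := by rw [← coe_idxBallF, Set.ncard_coe_finset]
  rw [coe_idxBallF, hN, ← levφ_def, ← levφ_def] at hE4
  have hΔterm : 54 * ((lev ℓ).D - (lev π).D) ^ 2 * ((idxBall X₀ (K.mw ℓ)).ncard : ℝ) ≤
      54 * ((lev ℓ).D - (lev π).D) ^ 2 * (K.Rhist * Nn1) := mul_le_mul_of_nonneg_left (SBK.ncard_mw_le hK X₀ hℓ) (by positivity)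
  by_cases hk : K.k₀ ≤ ℓ
  · have hpar := hT.hist_parent T hℓ1 hk
    refine ⟨K.p π, (lev ℓ).D - (lev π).D, SBK.p_nonneg hK π, SBK.p_le_hist hK (by omega) (by omega), hΔ2, hE4.trans ?_⟩
    calc 2 * idxEnergy (levφ S Ψ₀ st₀ (lev π)) (idxBall X₀ (K.mw ℓ)) + 54 * ((lev ℓ).D - (lev π).D) ^ 2 * ((idxBall X₀ (K.mw ℓ)).ncard : ℝ)
        ≤ 2 * (K.p π * (K.Rhist * Nn1)) + 54 * ((lev ℓ).D - (lev π).D) ^ 2 * (K.Rhist * Nn1) := by linarith only [hpar, hΔterm]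
      _ = K.Rhist * (2 * K.p π + 54 * ((lev ℓ).D - (lev π).D) ^ 2) * Nn1 := by ring
  · have hπ0 : π = 0 := by omega
    have htop := T.hist_top hℓ1 (by omega)
    refine ⟨K.P₀, (lev ℓ).D - (lev π).D, hK.hP₀, SBK.P₀_le_hist hK (by omega), hΔ2, hE4.trans ?_⟩
    rw [hπ0, hT.zero] at hΔterm ⊢
    calc 2 * idxEnergy (levφ S Ψ₀ st₀ st₀) (idxBall X₀ (K.mw ℓ)) + 54 * ((lev ℓ).D - st₀.D) ^ 2 * ((idxBall X₀ (K.mw ℓ)).ncard : ℝ)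
        ≤ 2 * (K.P₀ * (K.Rhist * Nn1)) + 54 * ((lev ℓ).D - st₀.D) ^ 2 * (K.Rhist * Nn1) := by linarith only [htop, hΔterm]
      _ = K.Rhist * (2 * K.P₀ + 54 * ((lev ℓ).D - st₀.D) ^ 2) * Nn1 := by ring

/-! ### XQ.2  The step's inputs from the tower -/

/-- ★ the (I4ˢ) instance of level `ℓ` in the shape of XK `sbModeStep` (from `TH.TF` through the level's chart class, bijectivity, tear-freeness and the far
budget XP `TowerInv.far`). -/
theorem TowerInv.I4 (T : TH K S Ψ₀ st₀ x X₀) (hT : TowerInv K S Ψ₀ st₀ X₀ ℓ lev) (hℓ : K.nlo ≤ K.n ℓ) :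
    ∀ g : E3 → E3, (∀ y, y ∉ S ∩ ball (atomOf S Ψ₀ (chartGen₁ st₀.L) (chartGen₂ st₀.L) st₀.w₁ X₀) (K.t ℓ) → g y = 0) →
      |∑ᶠ y ∈ S ∩ ball (atomOf S Ψ₀ (chartGen₁ st₀.L) (chartGen₂ st₀.L) st₀.w₁ X₀) (K.t ℓ),
          ⟪tailForce K.ϱ S (Layered (chartGen₁ (lev ℓ).L) (chartGen₂ (lev ℓ).L) (lev ℓ).w₁)
            (transReg Ψ₀ (chartGen₁ st₀.L) (chartGen₂ st₀.L) st₀.w₁ (chartGen₁ (lev ℓ).L) (chartGen₂ (lev ℓ).L) (lev ℓ).w₁) y, g y⟫_ℝ| ≤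
        (K.εf * Real.sqrt (bondEnergy (S ∩ ball (atomOf S Ψ₀ (chartGen₁ st₀.L) (chartGen₂ st₀.L) st₀.w₁ X₀) (K.τ ℓ))
            (fun p => p - transReg Ψ₀ (chartGen₁ st₀.L) (chartGen₂ st₀.L) st₀.w₁ (chartGen₁ (lev ℓ).L) (chartGen₂ (lev ℓ).L) (lev ℓ).w₁ p)) +
          K.AT * Real.sqrt (K.Θ ℓ * nK (S ∩ ball (atomOf S Ψ₀ (chartGen₁ st₀.L) (chartGen₂ st₀.L) st₀.w₁ X₀) (K.τ ℓ))) / max (K.τ ℓ - K.t ℓ) 1) *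
          Real.sqrt (bondEnergy (S ∩ ball (atomOf S Ψ₀ (chartGen₁ st₀.L) (chartGen₂ st₀.L) st₀.w₁ X₀) (K.τ ℓ)) g) := by
  have hK := T.ok
  have hOℓ := hT.levOK ℓ le_rfl
  obtain ⟨h49, h38⟩ := hT.tearFree T le_rfl hℓ
  have hbij : BijOn (levΨ Ψ₀ st₀ (lev ℓ)) S (LayeredHom ((lev ℓ).L : E3 →L[ℝ] E3) (lev ℓ).w) := by rw [← hOℓ.lay]; exact hOℓ.bij T hℓ
  obtain ⟨h8, h18⟩ := SBK.t_ge hK ℓ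
  have hτ : K.τ ℓ = 2 * K.t ℓ := rfl
  have h := T.TF (lev ℓ).L (lev ℓ).w (hOℓ.chart' T hℓ) (levΨ Ψ₀ st₀ (lev ℓ)) hbij h49 h38 x T.xS (K.t ℓ) (K.τ ℓ) (K.Θ ℓ) (by linarith)
    (by linarith) (SBK.Θ_nonneg hK ℓ) (hT.far T hℓ)
  rw [← hOℓ.lay, ← T.hX₀] at h
  exact h

/-- the far datum `F = Θ_ℓ·nK(S ∩ B(x, τ_ℓ))/max(τ_ℓ − t_ℓ, 1)²` against the next ball's count: `F ≤ 1000 C₁/(δ³ t_C³)·Θ_ℓ·#B_{n_{ℓ+1}}/n_ℓ²`. -/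
theorem TH.F_le (T : TH K S Ψ₀ st₀ x X₀) (hℓ : K.nlo ≤ K.n ℓ) :
    K.Θ ℓ * nK (S ∩ ball x (K.τ ℓ)) / max (K.τ ℓ - K.t ℓ) 1 ^ 2 ≤
      1000 * K.C₁ / (K.δ ^ 3 * K.tC ^ 3) * K.Θ ℓ * ((idxBall X₀ (K.n (ℓ + 1))).ncard : ℝ) / K.n ℓ ^ 2 := by
  have hK := T.ok
  obtain ⟨h8, h18⟩ := SBK.t_ge hK ℓ
  have hτ : K.τ ℓ = 2 * K.t ℓ := rfl
  have hδ := T.hδ; have hδ1 := hK.hδ1; have htC := hK.htC; have hC₁ := SBK.C₁_pos hK; have hn := SBK.n_pos hK ℓ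
  have hΘ := SBK.Θ_nonneg hK ℓ
  have hmax : max (K.τ ℓ - K.t ℓ) 1 = K.t ℓ := by rw [hτ, max_eq_left (by linarith)]; ring
  rw [hmax]
  -- packing: `nK(S ∩ B(x, τ)) ≤ (2τ/δ + 1)³ ≤ (5t/δ)³`
  have hτ0 : 0 < K.τ ℓ := by linarith
  have h1 := ncard_inter_ball_le_packing hδ T.sep x hτ0.le
  have h2 : (2 * K.τ ℓ / K.δ + 1) ^ 3 ≤ (5 * K.t ℓ / K.δ) ^ 3 := by
    refine pow_le_pow_left₀ (by positivity) ?_ 3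
    rw [hτ, div_add_one hδ.ne', div_le_div_iff_of_pos_right hδ]
    linarith
  have hN : nK (S ∩ ball x (K.τ ℓ)) ≤ 125 * K.t ℓ ^ 3 / K.δ ^ 3 := by
    have e : (5 * K.t ℓ / K.δ) ^ 3 = 125 * K.t ℓ ^ 3 / K.δ ^ 3 := by rw [div_pow]; ring
    exact (h1.trans h2).trans e.le
  -- `t ≤ 8 C₁ n`, `(t_C n)³ ≤ #B_{n_{ℓ+1}}`
  have ht8 : K.t ℓ ≤ 8 * K.C₁ * K.n ℓ := by
    unfold SBK.t
    have := hK.hnlot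
    have := mul_le_mul_of_nonneg_left hℓ hC₁.le
    linarith
  have hB : (K.tC * K.n ℓ) ^ 3 ≤ ((idxBall X₀ (K.n (ℓ + 1))).ncard : ℝ) := by
    rw [← SBK.n_succ]; exact cube_le_ncard_idxBall X₀ (SBK.n_pos hK _).le
  set N : ℝ := nK (S ∩ ball x (K.τ ℓ))
  set Nn1 : ℝ := ((idxBall X₀ (K.n (ℓ + 1))).ncard : ℝ)
  have hL : K.Θ ℓ * N / K.t ℓ ^ 2 ≤ 1000 * K.C₁ * K.Θ ℓ * K.n ℓ / K.δ ^ 3 := by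
    rw [div_le_div_iff₀ (by positivity) (by positivity)]
    have h3 : K.Θ ℓ * N * K.δ ^ 3 ≤ K.Θ ℓ * (125 * K.t ℓ ^ 3 / K.δ ^ 3) * K.δ ^ 3 :=
      mul_le_mul_of_nonneg_right (mul_le_mul_of_nonneg_left hN hΘ) (by positivity)
    have h4 : K.Θ ℓ * (125 * K.t ℓ ^ 3 / K.δ ^ 3) * K.δ ^ 3 = 125 * K.Θ ℓ * K.t ℓ ^ 2 * K.t ℓ := by field_simp
    have h5 := mul_le_mul_of_nonneg_left ht8 (by positivity : 0 ≤ 125 * K.Θ ℓ * K.t ℓ ^ 2)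
    calc K.Θ ℓ * N * K.δ ^ 3 ≤ 125 * K.Θ ℓ * K.t ℓ ^ 2 * K.t ℓ := h3.trans h4.le
      _ ≤ 125 * K.Θ ℓ * K.t ℓ ^ 2 * (8 * K.C₁ * K.n ℓ) := h5
      _ = 1000 * K.C₁ * K.Θ ℓ * K.n ℓ * K.t ℓ ^ 2 := by ring
  have hR : 1000 * K.C₁ * K.Θ ℓ * K.n ℓ / K.δ ^ 3 ≤ 1000 * K.C₁ / (K.δ ^ 3 * K.tC ^ 3) * K.Θ ℓ * Nn1 / K.n ℓ ^ 2 := by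
    rw [div_le_div_iff₀ (by positivity) (by positivity)]
    have e : 1000 * K.C₁ / (K.δ ^ 3 * K.tC ^ 3) * K.Θ ℓ * Nn1 * K.δ ^ 3 = 1000 * K.C₁ * K.Θ ℓ * (Nn1 / K.tC ^ 3) := by
      field_simp
    have h6 : K.n ℓ ^ 3 ≤ Nn1 / K.tC ^ 3 := by
      rw [le_div_iff₀ (by positivity)]
      calc K.n ℓ ^ 3 * K.tC ^ 3 = (K.tC * K.n ℓ) ^ 3 := by ring
        _ ≤ Nn1 := hB
    have h7 := mul_le_mul_of_nonneg_left h6 (by positivity : 0 ≤ 1000 * K.C₁ * K.Θ ℓ)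
    calc 1000 * K.C₁ * K.Θ ℓ * K.n ℓ * K.n ℓ ^ 2 = 1000 * K.C₁ * K.Θ ℓ * K.n ℓ ^ 3 := by ring
      _ ≤ 1000 * K.C₁ * K.Θ ℓ * (Nn1 / K.tC ^ 3) := h7
      _ = 1000 * K.C₁ / (K.δ ^ 3 * K.tC ^ 3) * K.Θ ℓ * Nn1 * K.δ ^ 3 := e.symm
  exact hL.trans hR

/-- ★ the E-SIDE OF THE STEP at level `ℓ`: XK `sbModeStep` fed by the tower (coherence set = the root window `9R`, drift `μ = D_ℓ`, window `m_w(ℓ)`,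
near/far radii `t_ℓ < τ_ℓ`, far budget `Θ_ℓ`), with the comparison error re-measured in the FLOOR constants `K.dA, K.dAϱ, K.δs` (XP.1). -/
theorem TowerInv.modeStep (T : TH K S Ψ₀ st₀ x X₀) (hT : TowerInv K S Ψ₀ st₀ X₀ ℓ lev) (hℓ1 : K.nlo ≤ K.n (ℓ + 1)) :
    ∃ M : Cell 2 → ℤ → E3, ∃ mM cE : ℝ, IsTruncMode K.ϱ (chartGen₁ (lev ℓ).L) (chartGen₂ (lev ℓ).L) (lev ℓ).w₁ M ∧ 0 ≤ mM ∧
      IsIdxLipschitz mM M ∧ 0 ≤ cE ∧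
      cE ≤ 3 * (K.dA ^ 2 * K.εf ^ 2 * idxEnergy (levφ S Ψ₀ st₀ (lev ℓ)) (idxBall X₀ (K.mw ℓ)) +
        K.dA * K.AT ^ 2 * (K.Θ ℓ * nK (S ∩ ball x (K.τ ℓ)) / max (K.τ ℓ - K.t ℓ) 1 ^ 2) +
        (1 / 2 * K.CT * K.δs * K.dAϱ) ^ 2 * idxEnergy (levφ S Ψ₀ st₀ (lev ℓ)) (idxBall X₀ (K.mw ℓ))) / K.κ₁ ^ 2 ∧
      mM ^ 2 * ((idxBall X₀ (K.n (ℓ + 1))).ncard : ℝ) ≤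
        K.CL * (2 + 2 * (K.CL * K.tC ^ 2)) * (2 * idxEnergy (levφ S Ψ₀ st₀ (lev ℓ)) (idxBall X₀ (K.n ℓ)) + 2 * cE) ∧
      idxEnergy (levφ S Ψ₀ st₀ (lev ℓ) - M) (idxBall X₀ (K.n (ℓ + 1))) ≤
        2 * cE + 2 * (K.CL * K.tC ^ 2 * ((idxBall X₀ (K.n (ℓ + 1))).ncard : ℝ) / ((idxBall X₀ (K.n ℓ)).ncard : ℝ)) *
          (2 * idxEnergy (levφ S Ψ₀ st₀ (lev ℓ)) (idxBall X₀ (K.n ℓ)) + 2 * cE) := by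
  have hK := T.ok
  have hℓ : K.nlo ≤ K.n ℓ := hℓ1.trans (SBK.n_succ_le hK ℓ)
  have hOℓ := hT.levOK ℓ le_rfl
  have hc := hK.hc₀; have hϱ := hK.hϱ; have hC₁ := SBK.C₁_pos hK; have htC := hK.htC
  set c : ℝ := K.c₀ - K.CR * (lev ℓ).DM with hcdef
  obtain ⟨-, hcfl, hCfl, hκfl, hcpos, hD2, -⟩ := hOℓ.floors T hℓ
  obtain ⟨hlip0, -⟩ := hT.lip ℓ le_rfl 0 (Nat.zero_le ℓ)
  rw [hT.zero, T.D₀, sub_zero] at hlip0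
  obtain ⟨h49, -⟩ := hT.tearFree T le_rfl hℓ
  have hHC := T.HC _ _ _ _ _ _ hcfl hCfl hκfl hOℓ.cryst hOℓ.tame hOℓ.coer
  obtain ⟨hMD, hMR⟩ := T.LD _ _ _ _ _ _ hcfl hCfl hκfl hOℓ.cryst hOℓ.tame hOℓ.coer
  obtain ⟨h8, h18⟩ := SBK.t_ge hK ℓ
  have hτ : K.τ ℓ = 2 * K.t ℓ := rfl
  have hτ0 : 0 < K.τ ℓ := by linarith
  obtain ⟨hmw1, hmw2⟩ := SBK.mw_le hK hℓ
  have hϱ0 : 0 ≤ K.ϱ := by linarith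
  have hϱc : K.ϱ / c ≤ 2 * K.ϱ / K.c₀ := by
    rw [div_le_div_iff₀ hcpos hc]
    have := mul_le_mul_of_nonneg_left hcfl hϱ0
    linarith
  have hϱc0 : 0 ≤ K.ϱ / c := div_nonneg hϱ0 hcpos.le
  have hn₁ : K.n₁ ≤ K.tC * K.n ℓ := by rw [← SBK.n_succ]; exact hK.hnlo₁.trans hℓ1
  have hm₁ : K.n ℓ + K.ϱ / c + 1 ≤ K.mw ℓ := by
    unfold SBK.mw
    have : 0 ≤ (2 * K.τ ℓ + 8) * (18 / K.c₀) := by positivity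
    linarith
  have hm₂ : (2 * K.τ ℓ + 8) * (9 / c) ≤ K.mw ℓ := by
    unfold SBK.mw
    have h9 : 9 / c ≤ 18 / K.c₀ := by rw [div_le_div_iff₀ hcpos hc]; linarith
    have := mul_le_mul_of_nonneg_left h9 (by positivity : 0 ≤ 2 * K.τ ℓ + 8)
    have := (SBK.n_pos hK ℓ).le
    have : 0 ≤ 2 * K.ϱ / K.c₀ := by positivity
    linarith
  have ht : 28 / 25 * (6 * K.C₁ * K.n ℓ + 8) < K.t ℓ := by
    unfold SBK.t
    have := mul_nonneg hC₁.le (SBK.n_pos hK ℓ).le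
    linarith
  have hr : 28 / 25 * (6 * K.C₁ * (K.ϱ / c) + 8) ≤ 28 / 25 * (6 * K.C₁ * (2 * K.ϱ / K.c₀) + 8) := by
    have := mul_le_mul_of_nonneg_left hϱc hC₁.le
    linarith
  have hKcoh : ∀ X ∈ idxBallF X₀ (K.mw ℓ), S ∩ closedBall (atomOf S Ψ₀ (chartGen₁ st₀.L) (chartGen₂ st₀.L) st₀.w₁ X)
      (28 / 25 * (6 * K.C₁ * (K.ϱ / c) + 8)) ⊆ atomsIn (μS S) 0 (9 * K.R) := fun X hX => T.coh_region (hmw1.trans hmw2) hr hX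
  have hω := hK.hω₁.le; have hϑ := hK.hϑ₁.le; have hμM := hK.hμM
  have hδs_le : (6 * K.C₁ * (K.ϱ / c) + 8) * (28 / 25 * K.ω₁ + K.ϑ₁) + (lev ℓ).D * (K.ϱ / c) ≤ K.δs := by
    unfold SBK.δs
    have e1 : 6 * K.C₁ * (K.ϱ / c) + 8 ≤ 6 * K.C₁ * (2 * K.ϱ / K.c₀) + 8 := by
      have := mul_le_mul_of_nonneg_left hϱc hC₁.le
      linarith
    have e2 := mul_le_mul_of_nonneg_right e1 (by positivity : 0 ≤ 28 / 25 * K.ω₁ + K.ϑ₁)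
    have e3 : (lev ℓ).D * (K.ϱ / c) ≤ 2 * K.μM * (2 * K.ϱ / K.c₀) := mul_le_mul hD2 hϱc hϱc0 (by linarith)
    linarith
  have hδs0 : 0 ≤ (6 * K.C₁ * (K.ϱ / c) + 8) * (28 / 25 * K.ω₁ + K.ϑ₁) + (lev ℓ).D * (K.ϱ / c) := by
    have := hOℓ.D0; positivity
  have hδs : (6 * K.C₁ * (K.ϱ / c) + 8) * (28 / 25 * K.ω₁ + K.ϑ₁) + (lev ℓ).D * (K.ϱ / c) ≤ 1 / 4 := hδs_le.trans hK.hδs4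
  obtain ⟨M, mM, hM, hmM0, hmM, hsize, hexc⟩ := sbModeStep T.hδ T.sep T.cleanP T.nash T.bij₀ T.iso T.clean₀ T.tame₀ T.c₀_pos T.cryst₀
    T.coh hω hϑ hcpos hOℓ.cryst hOℓ.clean hOℓ.nashH hOℓ.D0 hlip0 h49 T.lin hK.hCT T.CT hK.hκ₁ (by linarith) hHC
    (by linarith [hK.hCL]) htC.le (SBK.tC_le_one hK) hMD hMR hn₁ (SBK.n_pos hK ℓ).le hm₁ hm₂ ht hτ0.le hKcoh hδs
    (SBK.Θ_nonneg hK ℓ) hK.hεf.le hK.hAT (hT.I4 T hℓ)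
  rw [T.hX₀, ← levφ_def, ← SBK.n_succ] at hsize hexc
  -- the comparison error re-measured in the floor constants
  set cE := compErr K.κ₁ (dictA c 9) (dictA c K.ϱ) K.CT ((6 * K.C₁ * (K.ϱ / c) + 8) * (28 / 25 * K.ω₁ + K.ϑ₁) + (lev ℓ).D * (K.ϱ / c))
    K.εf K.AT (K.Θ ℓ * nK (S ∩ ball x (K.τ ℓ)) / max (K.τ ℓ - K.t ℓ) 1 ^ 2) (idxEnergy (levφ S Ψ₀ st₀ (lev ℓ)) (idxBall X₀ (K.mw ℓ)))
    with hcE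
  have hF0 : 0 ≤ K.Θ ℓ * nK (S ∩ ball x (K.τ ℓ)) / max (K.τ ℓ - K.t ℓ) 1 ^ 2 := by
    have := SBK.Θ_nonneg hK ℓ; have := nK_nonneg (S ∩ ball x (K.τ ℓ)); positivity
  have hEm0 := idxEnergy_nonneg (levφ S Ψ₀ st₀ (lev ℓ)) (idxBall X₀ (K.mw ℓ))
  have hcE0 : 0 ≤ cE := compErr_nonneg (dictA_nonneg _ _) hF0 hEm0
  have hcEle : cE ≤ compErr K.κ₁ K.dA K.dAϱ K.CT K.δs K.εf K.AT (K.Θ ℓ * nK (S ∩ ball x (K.τ ℓ)) / max (K.τ ℓ - K.t ℓ) 1 ^ 2)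
      (idxEnergy (levφ S Ψ₀ st₀ (lev ℓ)) (idxBall X₀ (K.mw ℓ))) :=
    compErr_mono (dictA_nonneg _ _) (dictA_anti (by linarith) hcfl (by norm_num)) (dictA_nonneg _ _)
      (dictA_anti (by linarith) hcfl hϱ0) hK.hCT hδs0 hδs_le hF0 hEm0
  exact ⟨M, mM, cE, hM, hmM0, hmM, hcE0, hcEle, hsize, hexc⟩

end Hist

end Summit.AtomisticToContinuum.Crystallization.Theorems.ChartedZeroExcessLayeredLatticeLiouville

end
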